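import Mathlib.Analysis.SpecialFunctions.Exponential
import Mathlib.Analysis.Calculus.MeanValue
import Mathlib.Analysis.Calculus.Deriv.Pow
import Mathlib.Analysis.CStarAlgebra.Classes
import Literature.MathematicalPhysics.QuantumLattice.LieTrotter
import HarnessLib

/-!
# First- and second-order Trotter error with commutator scaling (two summands; first order for Γ summands)

Topic `Literature/Computability/QuantumAlgorithms` (digital quantum simulation by product
formulas). The tree's `Literature/MathematicalPhysics/QuantumLattice/LieTrotter.lean` proves the
Lie product formula with the NORM-scaling rate `‖(e^{a/N}e^{b/N})^N − e^{a+b}‖ ≤ 6(‖a‖+‖b‖)² e^{5(‖a‖+‖b‖)}/N`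
(Reed–Simon VIII.29); that rate does not vanish when `a` and `b` commute. This file proves the
COMMUTATOR-scaling first-order bound of Childs–Su–Tran–Wiebe–Zhu, *Theory of Trotter error with
commutator scaling*, Phys. Rev. X 11, 011020 (2021) = arXiv:1912.08854 [ChildsSuTranWiebeZhu2021],
§5.1: for `H = A + B` and the first-order formula `𝒮₁(t) = e^{−itB} e^{−itA}`,

  “`‖𝒮₁(t) − e^{−itH}‖ ≤ (t²/2) ‖[B, A]‖`”  (their §5.1 display; Proposition 11 is the `Γ`-summand form),

together with the `r`-step consequence `‖𝒮₁(t/r)^r − e^{−itH}‖ ≤ (t²/(2r))‖[B,A]‖` of their §2.2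
(“The overall simulation has error `‖𝒮^r(t/r) − e^{tH}‖ ≤ r‖𝒮(t/r) − e^{(t/r)H}‖`”). The proof is the
printed one (§3.1/§5.1): the additive error is `∫₀ᵗ e^{(t−τ)H}[e^{τB}, A]e^{τA} dτ` (variation of
parameters) and the order condition `e^{τB}Ae^{−τB} − A = ∫₀^τ e^{τ₂B}[B,A]e^{−τ₂B} dτ₂` gives
`‖[e^{τB}, A]‖ ≤ τ‖[B,A]‖`; here both integrals are replaced by Mathlib's mean value inequalities
(`norm_image_sub_le_of_norm_deriv_le_segment'` with a constant bound, and
`image_norm_le_of_norm_deriv_right_le_deriv_boundary` with the growing bound `τ ↦ (τ²/2)‖[x,y]‖`), so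
no Bochner integral is needed.

pub-qadeq lane use (HONEST FRAMING: instance-level adjudication of specific advantage claims; no
claim about BQP vs BPP or the summit): the Trotterised-dynamics rows (CLAIMS E-17, E-37, E-38,
E-47; S-12's ‘first-order Trotter error of the δτ = 0.5 circuits’) quote this bound as the rigorous
ideal-circuit-vs-continuous-evolution error bar; nothing here refers to any experiment.

## Contents (all proved, no named facts)

* `TrotterError.norm_exp_smul_mul_sub_mul_exp_smul_le` — in a complete normed `ℝ`-algebra, if
  `‖e^{s x}‖ ≤ 1` on `[0, τ]` then `‖e^{τx} y − y e^{τx}‖ ≤ τ‖xy − yx‖` (the integrated order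
  condition).
* `TrotterError.norm_exp_mul_exp_sub_exp_add_le_comm` — **the two-term first-order bound** under
  CONTRACTION hypotheses (`‖e^{s x}‖, ‖e^{s y}‖, ‖e^{s(x+y)}‖ ≤ 1` for `s ∈ [0,t]`; this is the printed
  anti-Hermitian case `x = −iB`, `y = −iA`, where the three families are unitary, stated for the
  weakest hypotheses the printed proof uses): `‖e^{tx} e^{ty} − e^{t(x+y)}‖ ≤ (t²/2)‖xy − yx‖`.
* `TrotterError.norm_lieTrotter_sub_exp_le_comm` — `r = n+1` steps:
  `‖(e^{(t/r)x} e^{(t/r)y})^r − e^{t(x+y)}‖ ≤ (t²/(2r))‖xy − yx‖` (telescoping with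
  `LieTrotter.norm_pow_sub_pow_le'`).
* `TrotterError.firstOrderCommSum`, `TrotterError.lieTrotterOne` and
  **`TrotterError.norm_lieTrotterOne_sub_exp_le`** — Proposition 11 for a LIST of summands
  `x_1, …, x_Γ` (contraction form): `‖e^{t x_Γ}⋯e^{t x_1} − e^{t Σ x_γ}‖ ≤ (t²/2) Σ_{γ₁}‖[Σ_{γ₂>γ₁} x_{γ₂}, x_{γ₁}]‖`,
  by the printed telescoping triangle inequality.
* **Second order** (`TrotterError.norm_orderTwo_le`, `TrotterError.norm_strang_sub_exp_le_comm`):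
  the integrated order condition `‖𝒯₂(τ)‖ ≤ (τ²/2)(‖[y,[y,x]]‖ + ‖[x,[x,y]]‖)` for
  `𝒯₂(τ) = (e^{τy}xe^{−τy} − x) − (e^{−τx}ye^{τx} − y)` and the two-term Strang/Suzuki bound
  `‖e^{tx}e^{ty}e^{tx} − e^{t(x+y+x)}‖ ≤ (t³/6)(‖[y,[y,x]]‖ + ‖[x,[x,y]]‖)` under contraction hypotheses on
  `e^{±sx}`, `e^{±sy}`, `e^{s(x+y+x)}` — for `x = −iA/2`, `y = −iB` this is Proposition 12 (Γ = 2),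
  `‖𝒮₂(t) − e^{−itH}‖ ≤ (t³/12)‖[B,[B,A]]‖ + (t³/24)‖[A,[A,B]]‖`; `r` steps
  `norm_strang_pow_sub_exp_le_comm` (`t³/(6r²)`); C⋆ forms `norm_strang_sub_exp_le_of_mem_skewAdjoint`
  and, literally as printed for self-adjoint `A`, `B`, `norm_strang_sub_exp_le_of_isSelfAdjoint`.
* `TrotterError.doubleSum`, `TrotterError.strang`, `TrotterError.secondOrderCommSum` and
  **`TrotterError.norm_strang_sub_exp_le`** — Proposition 12 for a LIST of half summands (contraction
  form), by the printed telescoping.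
* `norm_exp_smul_le_one_of_mem_skewAdjoint` — in a C⋆-algebra `e^{s x}` is unitary, hence a
  contraction, for skew-adjoint `x` (Mathlib's `NormedSpace.exp_mem_unitary_of_mem_skewAdjoint`).
* `norm_lieTrotter_one_sub_exp_le_of_isSelfAdjoint` — **the printed statement**: for self-adjoint
  `A`, `B` in a C⋆-algebra and `t ≥ 0`,
  `‖e^{t(−iB)} e^{t(−iA)} − e^{t(−i(A+B))}‖ ≤ (t²/2)‖BA − AB‖`;
  `norm_lieTrotter_pow_sub_exp_le_of_isSelfAdjoint` — its `r`-step form (nontrivial C⋆-algebra).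

## What is NOT here

The C⋆-algebra (Hermitian) specialisation of the `Γ`-summand statement (only the two-term one
is spelled out below; the list form applies verbatim with `x_γ = −iH_γ`), the `r`-step form of the second-order bound for `Γ > 2`, and the higher-order commutator-scaling
theory of §§3–4; no statement about any particular Hamiltonian.

## References

* A. M. Childs, Y. Su, M. C. Tran, N. Wiebe, S. Zhu, *Theory of Trotter error with commutator
  scaling*, Phys. Rev. X 11, 011020 (2021), arXiv:1912.08854: §2.2 (error accumulation over `r`
  steps; “we directly evaluate the spectral norm of a matrix exponential to 1” in the anti-Hermitian
  case), §3.1 (additive error of the Lie–Trotter formula by variation of parameters), §5.1 and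
  Proposition 11 (tight first-order bound) [ChildsSuTranWiebeZhu2021].
* M. Reed, B. Simon, *Methods of Modern Mathematical Physics I*, Thm VIII.29 (Lie product formula;
  the tree's `LieTrotter.lean`).
-/

noncomputable section

namespace Literature.Computability.QuantumAlgorithms

open NormedSpace Set

namespace TrotterError

variable {𝔸 : Type*} [NormedRing 𝔸] [NormedAlgebra ℝ 𝔸] [CompleteSpace 𝔸]

/-! ### Derivatives of the exponentials involved -/

/-- `d/dσ e^{(τ-σ)x} = -(x e^{(τ-σ)x})` (calculus plumbing). [folklore] -/
private theorem hasDerivAt_exp_sub_smul (x : 𝔸) (τ σ : ℝ) :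
    HasDerivAt (fun u : ℝ => exp ((τ - u) • x)) (-(x * exp ((τ - σ) • x))) σ := by
  have h1 : HasDerivAt (fun u : ℝ => τ - u) (-1) σ := by
    simpa using (hasDerivAt_id σ).const_sub τ
  have h2 : HasDerivAt (fun u : ℝ => exp ((τ - u) • x)) ((-1 : ℝ) • (x * exp ((τ - σ) • x))) σ :=
    (hasDerivAt_exp_smul_const' (𝕂 := ℝ) x (τ - σ)).scomp σ h1
  simpa using h2

omit [CompleteSpace 𝔸] in
/-- The exponential `e^{s x}` commutes with `x` (plumbing). [folklore] -/
private theorem exp_smul_comm (x : 𝔸) (s : ℝ) : exp (s • x) * x = x * exp (s • x) :=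
  ((Commute.refl x).smul_left s).exp_left.eq

/-! ### The commutator of `y` with `e^{τx}` grows at most linearly -/

/-- **Order condition of the first-order formula, integrated**: if `‖e^{s x}‖ ≤ 1` for
`s ∈ [0, τ]`, then `‖e^{τ x} y - y e^{τ x}‖ ≤ τ ‖x y - y x‖` — the bound
`e^{τB} A e^{-τB} - A = ∫₀^τ e^{τ₂B}[B,A]e^{-τ₂B} dτ₂ = O(‖[B,A]‖ τ)`, here obtained from the mean
value inequality applied to `σ ↦ e^{(τ-σ)x}(e^{σx} y - y e^{σx})`, whose derivative is
`e^{(τ-σ)x} [x,y] e^{σx}`. [cite: ChildsSuTranWiebeZhu2021, §5.1 (order condition and its integral form)] -/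
theorem norm_exp_smul_mul_sub_mul_exp_smul_le (x y : 𝔸) {τ : ℝ} (hτ : 0 ≤ τ)
    (hx : ∀ s ∈ Icc (0 : ℝ) τ, ‖exp (s • x)‖ ≤ 1) :
    ‖exp (τ • x) * y - y * exp (τ • x)‖ ≤ τ * ‖x * y - y * x‖ := by
  -- K(σ) = e^{(τ-σ)x} D(σ), D(σ) = e^{σx} y - y e^{σx}
  set K : ℝ → 𝔸 := fun σ => exp ((τ - σ) • x) * (exp (σ • x) * y - y * exp (σ • x)) with hK
  have hD : ∀ σ, HasDerivAt (fun u : ℝ => exp (u • x) * y - y * exp (u • x))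
      (x * exp (σ • x) * y - y * (exp (σ • x) * x)) σ := by
    intro σ
    have h1 := (hasDerivAt_exp_smul_const' (𝕂 := ℝ) x σ).mul_const y
    have h2 := (hasDerivAt_exp_smul_const (𝕂 := ℝ) x σ).const_mul y
    exact h1.sub h2
  have hK' : ∀ σ, HasDerivAt K (exp ((τ - σ) • x) * (x * y - y * x) * exp (σ • x)) σ := by
    intro σ
    have h := (hasDerivAt_exp_sub_smul x τ σ).mul (hD σ)
    have heq : -(x * exp ((τ - σ) • x)) * (exp (σ • x) * y - y * exp (σ • x)) +
        exp ((τ - σ) • x) * (x * exp (σ • x) * y - y * (exp (σ • x) * x)) =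
        exp ((τ - σ) • x) * (x * y - y * x) * exp (σ • x) := by
      rw [← exp_smul_comm x (τ - σ), exp_smul_comm x σ]
      noncomm_ring
    rw [heq] at h
    exact h
  have hbound : ∀ σ ∈ Ico (0 : ℝ) τ,
      ‖exp ((τ - σ) • x) * (x * y - y * x) * exp (σ • x)‖ ≤ ‖x * y - y * x‖ := by
    intro σ hσ
    have h1 : ‖exp ((τ - σ) • x)‖ ≤ 1 := hx (τ - σ) ⟨by linarith [hσ.2.le], by linarith [hσ.1]⟩
    have h2 : ‖exp (σ • x)‖ ≤ 1 := hx σ ⟨hσ.1, hσ.2.le⟩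
    calc ‖exp ((τ - σ) • x) * (x * y - y * x) * exp (σ • x)‖
        ≤ ‖exp ((τ - σ) • x)‖ * ‖x * y - y * x‖ * ‖exp (σ • x)‖ :=
          (norm_mul_le _ _).trans (mul_le_mul_of_nonneg_right (norm_mul_le _ _) (norm_nonneg _))
      _ ≤ 1 * ‖x * y - y * x‖ * 1 := by gcongr
      _ = ‖x * y - y * x‖ := by ring
  have hmvt := norm_image_sub_le_of_norm_deriv_le_segment' (f := K)
    (fun σ _ => (hK' σ).hasDerivWithinAt) hbound τ (right_mem_Icc.2 hτ)
  have hK0 : K 0 = 0 := by simp [hK]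
  have hKτ : K τ = exp (τ • x) * y - y * exp (τ • x) := by simp [hK]
  rw [hK0, sub_zero, hKτ, sub_zero] at hmvt
  linarith [hmvt, mul_comm ‖x * y - y * x‖ τ]

/-! ### The two-term first-order bound -/

/-- **First-order Trotter error with commutator scaling, two summands.** In a complete normed
algebra, if the one-parameter families `e^{s x}`, `e^{s y}`, `e^{s (x+y)}` are contractions for
`s ∈ [0, t]` (the case of anti-Hermitian `x = -iB`, `y = -iA` in a C⋆-algebra, where they are
unitary), then
`‖e^{t x} e^{t y} - e^{t (x + y)}‖ ≤ (t²/2) ‖x y - y x‖`.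
This is the printed `‖𝒮₁(t) - e^{-itH}‖ ≤ (t²/2)‖[B,A]‖` for `H = A + B`, `𝒮₁(t) = e^{-itB} e^{-itA}`
(`x = -iB`, `y = -iA`, `[x,y] = -[B,A]`), proved along the printed route: the additive error is
`∫₀ᵗ e^{(t-τ)H}[e^{τB}, A]e^{τA} dτ` and `‖[e^{τB}, A]‖ ≤ τ‖[B,A]‖`; here the integral is replaced by
the mean value inequality with the growing bound `τ ↦ (τ²/2)‖[x,y]‖`.
[cite: ChildsSuTranWiebeZhu2021, §5.1 (eq. ‖𝒮₁(t) − e^{−itH}‖ ≤ (t²/2)‖[B,A]‖; Proposition 11 with Γ = 2)] -/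
theorem norm_exp_mul_exp_sub_exp_add_le_comm (x y : 𝔸) {t : ℝ} (ht : 0 ≤ t)
    (hx : ∀ s ∈ Icc (0 : ℝ) t, ‖exp (s • x)‖ ≤ 1) (hy : ∀ s ∈ Icc (0 : ℝ) t, ‖exp (s • y)‖ ≤ 1)
    (hxy : ∀ s ∈ Icc (0 : ℝ) t, ‖exp (s • (x + y))‖ ≤ 1) :
    ‖exp (t • x) * exp (t • y) - exp (t • (x + y))‖ ≤ t ^ 2 / 2 * ‖x * y - y * x‖ := by
  set c : ℝ := ‖x * y - y * x‖ with hc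
  -- F(τ) = e^{(t-τ)(x+y)} e^{τx} e^{τy};  f = F - F(0)
  set F : ℝ → 𝔸 := fun τ => exp ((t - τ) • (x + y)) * (exp (τ • x) * exp (τ • y)) with hF
  have hP : ∀ τ, HasDerivAt (fun u : ℝ => exp (u • x) * exp (u • y))
      (exp (τ • x) * x * exp (τ • y) + exp (τ • x) * (y * exp (τ • y))) τ := fun τ =>
    (hasDerivAt_exp_smul_const (𝕂 := ℝ) x τ).mul (hasDerivAt_exp_smul_const' (𝕂 := ℝ) y τ)
  have hF' : ∀ τ, HasDerivAt F
      (exp ((t - τ) • (x + y)) * (exp (τ • x) * y - y * exp (τ • x)) * exp (τ • y)) τ := by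
    intro τ
    have h := (hasDerivAt_exp_sub_smul (x + y) t τ).mul (hP τ)
    have heq : -((x + y) * exp ((t - τ) • (x + y))) * (exp (τ • x) * exp (τ • y)) +
        exp ((t - τ) • (x + y)) * (exp (τ • x) * x * exp (τ • y) + exp (τ • x) * (y * exp (τ • y))) =
        exp ((t - τ) • (x + y)) * (exp (τ • x) * y - y * exp (τ • x)) * exp (τ • y) := by
      rw [← exp_smul_comm (x + y) (t - τ), exp_smul_comm x τ]
      noncomm_ring
    rw [heq] at h
    exact h
  -- the derivative bound ‖F'(τ)‖ ≤ c τ on [0, t)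
  have hbound : ∀ τ ∈ Ico (0 : ℝ) t,
      ‖exp ((t - τ) • (x + y)) * (exp (τ • x) * y - y * exp (τ • x)) * exp (τ • y)‖ ≤ c * τ := by
    intro τ hτ
    have h1 : ‖exp ((t - τ) • (x + y))‖ ≤ 1 := hxy (t - τ) ⟨by linarith [hτ.2.le], by linarith [hτ.1]⟩
    have h2 : ‖exp (τ • y)‖ ≤ 1 := hy τ ⟨hτ.1, hτ.2.le⟩
    have h3 : ‖exp (τ • x) * y - y * exp (τ • x)‖ ≤ τ * c :=
      norm_exp_smul_mul_sub_mul_exp_smul_le x y hτ.1 fun s hs => hx s ⟨hs.1, hs.2.trans hτ.2.le⟩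
    have hc0 : 0 ≤ τ * c := mul_nonneg hτ.1 (norm_nonneg _)
    calc ‖exp ((t - τ) • (x + y)) * (exp (τ • x) * y - y * exp (τ • x)) * exp (τ • y)‖
        ≤ ‖exp ((t - τ) • (x + y))‖ * ‖exp (τ • x) * y - y * exp (τ • x)‖ * ‖exp (τ • y)‖ :=
          (norm_mul_le _ _).trans (mul_le_mul_of_nonneg_right (norm_mul_le _ _) (norm_nonneg _))
      _ ≤ 1 * (τ * c) * 1 := by gcongr
      _ = c * τ := by ring
  -- comparison with B(τ) = c τ² / 2
  have hcont : ContinuousOn (fun τ => F τ - F 0) (Icc 0 t) :=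
    (HasDerivAt.continuousOn fun τ _ => (hF' τ).sub_const (F 0))
  have hderiv : ∀ τ ∈ Ico (0 : ℝ) t, HasDerivWithinAt (fun τ => F τ - F 0)
      (exp ((t - τ) • (x + y)) * (exp (τ • x) * y - y * exp (τ • x)) * exp (τ • y)) (Ici τ) τ :=
    fun τ _ => ((hF' τ).sub_const (F 0)).hasDerivWithinAt
  have hB : ∀ τ : ℝ, HasDerivAt (fun τ : ℝ => c * τ ^ 2 / 2) (c * τ) τ := by
    intro τ
    have h := ((hasDerivAt_pow 2 τ).const_mul c).div_const 2
    have heq : c * ((2 : ℕ) * τ ^ (2 - 1)) / 2 = c * τ := by norm_num; ring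
    rw [heq] at h
    exact h
  have h0 : ‖F 0 - F 0‖ ≤ c * (0 : ℝ) ^ 2 / 2 := by simp
  have key := image_norm_le_of_norm_deriv_right_le_deriv_boundary hcont hderiv h0 hB hbound
    (right_mem_Icc.2 ht)
  have hFt : F t = exp (t • x) * exp (t • y) := by simp [hF]
  have hF0 : F 0 = exp (t • (x + y)) := by simp [hF]
  rw [hFt, hF0] at key
  simpa [hc, mul_comm, mul_div_assoc] using key


/-! ### `r` Trotter steps -/

/-- **`r` Trotter steps**: under the same contraction hypotheses on `[0, t]`, for `r ≥ 1`,
`‖(e^{(t/r) x} e^{(t/r) y})^r - e^{t (x+y)}‖ ≤ (t²/(2r)) ‖x y - y x‖` — “we divide the evolution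
into `r` steps and apply the product formula within each step. The overall simulation has error
`‖𝒮^r(t/r) − e^{tH}‖ ≤ r‖𝒮(t/r) − e^{(t/r)H}‖`”, combined with the two-term first-order bound.
[cite: ChildsSuTranWiebeZhu2021, §2.2 (error accumulation over r steps) and §5.1] -/
theorem norm_lieTrotter_sub_exp_le_comm [NormOneClass 𝔸] (x y : 𝔸) {t : ℝ} (ht : 0 ≤ t)
    (hx : ∀ s ∈ Icc (0 : ℝ) t, ‖exp (s • x)‖ ≤ 1) (hy : ∀ s ∈ Icc (0 : ℝ) t, ‖exp (s • y)‖ ≤ 1)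
    (hxy : ∀ s ∈ Icc (0 : ℝ) t, ‖exp (s • (x + y))‖ ≤ 1) (n : ℕ) :
    ‖(exp ((t / (n + 1)) • x) * exp ((t / (n + 1)) • y)) ^ (n + 1) - exp (t • (x + y))‖ ≤
      t ^ 2 / (2 * (n + 1)) * ‖x * y - y * x‖ := by
  have hn : (0 : ℝ) < n + 1 := by positivity
  have hτ0 : 0 ≤ t / (n + 1) := div_nonneg ht hn.le
  have hτt : t / (n + 1) ≤ t := div_le_self ht (by linarith)
  have hsub : ∀ s ∈ Icc (0 : ℝ) (t / (n + 1)), s ∈ Icc (0 : ℝ) t := fun s hs => ⟨hs.1, hs.2.trans hτt⟩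
  -- one step
  have hstep := norm_exp_mul_exp_sub_exp_add_le_comm x y hτ0 (fun s hs => hx s (hsub s hs))
    (fun s hs => hy s (hsub s hs)) (fun s hs => hxy s (hsub s hs))
  -- norms of the two one-step operators
  have hX : ‖exp ((t / (n + 1)) • x) * exp ((t / (n + 1)) • y)‖ ≤ 1 :=
    (norm_mul_le _ _).trans (by
      have h1 := hx _ ⟨hτ0, hτt⟩
      have h2 := hy _ ⟨hτ0, hτt⟩
      nlinarith [norm_nonneg (exp ((t / (n + 1)) • x)), norm_nonneg (exp ((t / (n + 1)) • y))])
  have hY : ‖exp ((t / (n + 1)) • (x + y))‖ ≤ 1 := hxy _ ⟨hτ0, hτt⟩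
  -- `e^{t(x+y)} = (e^{(t/(n+1))(x+y)})^{n+1}`
  have hpow : exp (t • (x + y)) = exp ((t / (n + 1)) • (x + y)) ^ (n + 1) := by
    letI : NormedAlgebra ℚ 𝔸 := NormedAlgebra.restrictScalars ℚ ℝ 𝔸
    rw [← exp_nsmul, ← Nat.cast_smul_eq_nsmul ℝ, smul_smul]
    congr 1
    push_cast
    field_simp
  rw [hpow]
  have htel := Literature.MathematicalPhysics.QuantumLattice.norm_pow_sub_pow_le'
    (exp ((t / (n + 1)) • x) * exp ((t / (n + 1)) • y)) (exp ((t / (n + 1)) • (x + y))) hX hY n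
  rw [one_pow, mul_one] at htel
  calc ‖(exp ((t / (n + 1)) • x) * exp ((t / (n + 1)) • y)) ^ (n + 1) -
          exp ((t / (n + 1)) • (x + y)) ^ (n + 1)‖
      ≤ (n + 1) * ‖exp ((t / (n + 1)) • x) * exp ((t / (n + 1)) • y) -
          exp ((t / (n + 1)) • (x + y))‖ := htel
    _ ≤ (n + 1) * ((t / (n + 1)) ^ 2 / 2 * ‖x * y - y * x‖) := by gcongr
    _ = t ^ 2 / (2 * (n + 1)) * ‖x * y - y * x‖ := by field_simp

/-! ### `Γ` summands (Proposition 11) -/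

/-- The commutator sum of Proposition 11 for the summands `x₁, …, x_Γ` (list order):
`Σ_{γ₁} ‖[Σ_{γ₂ > γ₁} x_{γ₂}, x_{γ₁}]‖`, i.e. for `x :: rest` the term `‖(Σ rest) x − x (Σ rest)‖` plus
the sum for `rest`. [cite: ChildsSuTranWiebeZhu2021, §5.1 Proposition 11] -/
def firstOrderCommSum : List 𝔸 → ℝ
  | [] => 0
  | x :: rest => ‖rest.sum * x - x * rest.sum‖ + firstOrderCommSum rest

omit [NormedAlgebra ℝ 𝔸] [CompleteSpace 𝔸] in
/-- `firstOrderCommSum [] = 0`. [cite: ChildsSuTranWiebeZhu2021, §5.1 Proposition 11] -/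
@[simp] theorem firstOrderCommSum_nil : firstOrderCommSum ([] : List 𝔸) = 0 := rfl

omit [NormedAlgebra ℝ 𝔸] [CompleteSpace 𝔸] in
/-- `firstOrderCommSum (x :: rest) = ‖(Σ rest) x − x (Σ rest)‖ + firstOrderCommSum rest`.
[cite: ChildsSuTranWiebeZhu2021, §5.1 Proposition 11] -/
@[simp] theorem firstOrderCommSum_cons (x : 𝔸) (rest : List 𝔸) :
    firstOrderCommSum (x :: rest) = ‖rest.sum * x - x * rest.sum‖ + firstOrderCommSum rest := rfl

omit [NormedAlgebra ℝ 𝔸] [CompleteSpace 𝔸] in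
/-- `firstOrderCommSum` is nonnegative. [cite: ChildsSuTranWiebeZhu2021, §5.1 Proposition 11] -/
theorem firstOrderCommSum_nonneg : ∀ xs : List 𝔸, 0 ≤ firstOrderCommSum xs
  | [] => le_rfl
  | x :: rest => by rw [firstOrderCommSum_cons]; exact add_nonneg (norm_nonneg _) (firstOrderCommSum_nonneg rest)

/-- The first-order product formula `𝒮₁(t) = e^{t x_Γ} ⋯ e^{t x_2} e^{t x_1}` for the summand list
`[x_1, …, x_Γ]` (later summands act to the left, as in `𝒮₁(t) = e^{−itB} e^{−itA}` for `H = A + B`,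
`H₁ = A`, `H₂ = B`). [cite: ChildsSuTranWiebeZhu2021, §2.1 (first-order Lie–Trotter formula) and §5.1] -/
def lieTrotterOne (t : ℝ) (xs : List 𝔸) : 𝔸 := (xs.map fun x => exp (t • x)).reverse.prod

omit [CompleteSpace 𝔸] in
/-- No summands: the empty product. [cite: ChildsSuTranWiebeZhu2021, §2.1] -/
@[simp] theorem lieTrotterOne_nil (t : ℝ) : lieTrotterOne t ([] : List 𝔸) = 1 := by
  simp [lieTrotterOne]

omit [CompleteSpace 𝔸] in
/-- One more (first) summand acts first, i.e. rightmost: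
`𝒮₁(t)[x :: rest] = 𝒮₁(t)[rest] · e^{t x}`. [cite: ChildsSuTranWiebeZhu2021, §2.1] -/
theorem lieTrotterOne_cons (t : ℝ) (x : 𝔸) (rest : List 𝔸) :
    lieTrotterOne t (x :: rest) = lieTrotterOne t rest * exp (t • x) := by
  simp [lieTrotterOne, List.prod_append]

/-- **Proposition 11 (tight error bound for the first-order Lie–Trotter formula), contraction
form.** For summands `x_1, …, x_Γ` in a complete normed `ℝ`-algebra such that every summand and
every tail sum `Σ_{γ ≥ γ₀} x_γ` generates contractions on `[0, t]` (automatic for anti-Hermitian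
summands `x_γ = −iH_γ`), `‖𝒮₁(t) − e^{t Σ x_γ}‖ ≤ (t²/2) Σ_{γ₁} ‖[Σ_{γ₂>γ₁} x_{γ₂}, x_{γ₁}]‖`. Proof as
printed: telescoping triangle inequality, one two-term bound per summand.
[cite: ChildsSuTranWiebeZhu2021, §5.1 Proposition 11] -/
theorem norm_lieTrotterOne_sub_exp_le (t : ℝ) (ht : 0 ≤ t) :
    ∀ xs : List 𝔸, (∀ x ∈ xs, ∀ s ∈ Icc (0 : ℝ) t, ‖exp (s • x)‖ ≤ 1) →
      (∀ zs : List 𝔸, zs <:+ xs → ∀ s ∈ Icc (0 : ℝ) t, ‖exp (s • zs.sum)‖ ≤ 1) →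
      ‖lieTrotterOne t xs - exp (t • xs.sum)‖ ≤ t ^ 2 / 2 * firstOrderCommSum xs
  | [], _, _ => by simp
  | x :: rest, hel, hsuf => by
    have ih := norm_lieTrotterOne_sub_exp_le t ht rest (fun y hy => hel y (List.mem_cons_of_mem x hy))
      (fun zs hzs => hsuf zs (hzs.trans (List.suffix_cons x rest)))
    have hx : ∀ s ∈ Icc (0 : ℝ) t, ‖exp (s • x)‖ ≤ 1 := hel x List.mem_cons_self
    have hS : ∀ s ∈ Icc (0 : ℝ) t, ‖exp (s • rest.sum)‖ ≤ 1 := hsuf rest (List.suffix_cons x rest)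
    have hSx : ∀ s ∈ Icc (0 : ℝ) t, ‖exp (s • (rest.sum + x))‖ ≤ 1 := by
      intro s hs
      have h := hsuf (x :: rest) (List.suffix_refl _) s hs
      rwa [List.sum_cons, add_comm] at h
    have h2 := norm_exp_mul_exp_sub_exp_add_le_comm rest.sum x ht hS hx hSx
    rw [lieTrotterOne_cons, List.sum_cons, firstOrderCommSum_cons, add_comm x rest.sum]
    -- telescoping: (P_rest − e^{tS}) e^{tx} + (e^{tS} e^{tx} − e^{t(S+x)})
    have hsplit : lieTrotterOne t rest * exp (t • x) - exp (t • (rest.sum + x)) =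
        (lieTrotterOne t rest - exp (t • rest.sum)) * exp (t • x) +
          (exp (t • rest.sum) * exp (t • x) - exp (t • (rest.sum + x))) := by noncomm_ring
    rw [hsplit]
    have hxt : ‖exp (t • x)‖ ≤ 1 := hx t ⟨ht, le_rfl⟩
    calc ‖(lieTrotterOne t rest - exp (t • rest.sum)) * exp (t • x) +
          (exp (t • rest.sum) * exp (t • x) - exp (t • (rest.sum + x)))‖
        ≤ ‖lieTrotterOne t rest - exp (t • rest.sum)‖ * ‖exp (t • x)‖ +
            ‖exp (t • rest.sum) * exp (t • x) - exp (t • (rest.sum + x))‖ :=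
          (norm_add_le _ _).trans (add_le_add (norm_mul_le _ _) le_rfl)
      _ ≤ t ^ 2 / 2 * firstOrderCommSum rest * 1 + t ^ 2 / 2 * ‖rest.sum * x - x * rest.sum‖ := by
          gcongr
          · exact mul_nonneg (by positivity) (firstOrderCommSum_nonneg rest)
      _ = t ^ 2 / 2 * (‖rest.sum * x - x * rest.sum‖ + firstOrderCommSum rest) := by ring

/-! ### Second order (Suzuki / Strang splitting), two summands -/

/-- `d/du e^{(-u) y} = -(e^{(-u) y} y)` (plumbing). [folklore] -/
private theorem hasDerivAt_exp_neg_smul (y : 𝔸) (τ : ℝ) :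
    HasDerivAt (fun u : ℝ => exp ((-u) • y)) (-(exp ((-τ) • y) * y)) τ := by
  have h := (hasDerivAt_exp_smul_const (𝕂 := ℝ) y (-τ)).scomp τ (hasDerivAt_neg τ)
  refine h.congr_deriv ?_
  rw [neg_one_smul]

/-- Derivative of a conjugation: `d/du (e^{uy} c e^{-uy}) = e^{uy} (y c - c y) e^{-uy}` (plumbing).
[folklore] -/
private theorem hasDerivAt_conj (y c : 𝔸) (τ : ℝ) :
    HasDerivAt (fun u : ℝ => exp (u • y) * c * exp ((-u) • y))
      (exp (τ • y) * (y * c - c * y) * exp ((-τ) • y)) τ := by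
  have h := ((hasDerivAt_exp_smul_const' (𝕂 := ℝ) y τ).mul_const c).mul (hasDerivAt_exp_neg_smul y τ)
  refine h.congr_deriv ?_
  rw [← exp_smul_comm y τ, exp_smul_comm y (-τ)]
  noncomm_ring

/-- Derivative of the opposite conjugation: `d/du (e^{-ux} c e^{ux}) = e^{-ux} (c x - x c) e^{ux}`
(plumbing). [folklore] -/
private theorem hasDerivAt_conj' (x c : 𝔸) (τ : ℝ) :
    HasDerivAt (fun u : ℝ => exp ((-u) • x) * c * exp (u • x))
      (exp ((-τ) • x) * (c * x - x * c) * exp (τ • x)) τ := by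
  have h := ((hasDerivAt_exp_neg_smul x τ).mul_const c).mul (hasDerivAt_exp_smul_const (𝕂 := ℝ) x τ)
  refine h.congr_deriv ?_
  rw [exp_smul_comm x τ]
  noncomm_ring

omit [NormedAlgebra ℝ 𝔸] [CompleteSpace 𝔸] in
/-- Norm of a conjugated element between contractions (plumbing). [folklore] -/
private theorem norm_conj_le {P Q c : 𝔸} (hP : ‖P‖ ≤ 1) (hQ : ‖Q‖ ≤ 1) : ‖P * c * Q‖ ≤ ‖c‖ :=
  calc ‖P * c * Q‖ ≤ ‖P‖ * ‖c‖ * ‖Q‖ :=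
      (norm_mul_le _ _).trans (mul_le_mul_of_nonneg_right (norm_mul_le _ _) (norm_nonneg _))
    _ ≤ 1 * ‖c‖ * 1 := by gcongr
    _ = ‖c‖ := by ring

/-- **Second-order order condition, integrated.** With
`T(τ) = (e^{τy} x e^{-τy} - x) - (e^{-τx} y e^{τx} - y)` (the operator `𝒯₂(τ₁)` of the printed
derivation, for `x = -iA/2`, `y = -iB`): if `e^{±s x}`, `e^{±s y}` are contractions for `s ∈ [0, τ]`,
then `‖T(τ)‖ ≤ (τ²/2)(‖[y,[y,x]]‖ + ‖[x,[x,y]]‖)`, because `T(0) = 0`, `T'(0) = [y,x] - [y,x] = 0`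
and `‖T''‖ ≤ ‖[y,[y,x]]‖ + ‖[x,[x,y]]‖` (two mean value inequalities).
[cite: ChildsSuTranWiebeZhu2021, §5.1 (order condition 𝒯₂(τ₁) = O(τ₁²), derivation of Proposition 12)] -/
theorem norm_orderTwo_le (x y : 𝔸) {τ : ℝ} (hτ : 0 ≤ τ)
    (hx : ∀ s ∈ Icc (0 : ℝ) τ, ‖exp (s • x)‖ ≤ 1) (hx' : ∀ s ∈ Icc (0 : ℝ) τ, ‖exp ((-s) • x)‖ ≤ 1)
    (hy : ∀ s ∈ Icc (0 : ℝ) τ, ‖exp (s • y)‖ ≤ 1) (hy' : ∀ s ∈ Icc (0 : ℝ) τ, ‖exp ((-s) • y)‖ ≤ 1) :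
    ‖(exp (τ • y) * x * exp ((-τ) • y) - x) - (exp ((-τ) • x) * y * exp (τ • x) - y)‖ ≤
      τ ^ 2 / 2 * (‖y * (y * x - x * y) - (y * x - x * y) * y‖ +
        ‖x * (x * y - y * x) - (x * y - y * x) * x‖) := by
  set K : ℝ := ‖y * (y * x - x * y) - (y * x - x * y) * y‖ +
    ‖x * (x * y - y * x) - (x * y - y * x) * x‖ with hK
  set T : ℝ → 𝔸 := fun u => (exp (u • y) * x * exp ((-u) • y) - x) -
    (exp ((-u) • x) * y * exp (u • x) - y) with hT
  set T' : ℝ → 𝔸 := fun u => exp (u • y) * (y * x - x * y) * exp ((-u) • y) -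
    exp ((-u) • x) * (y * x - x * y) * exp (u • x) with hT'
  have hTd : ∀ u, HasDerivAt T (T' u) u := fun u =>
    ((hasDerivAt_conj y x u).sub_const x).sub ((hasDerivAt_conj' x y u).sub_const y)
  have hT'd : ∀ u, HasDerivAt T'
      (exp (u • y) * (y * (y * x - x * y) - (y * x - x * y) * y) * exp ((-u) • y) -
        exp ((-u) • x) * ((y * x - x * y) * x - x * (y * x - x * y)) * exp (u • x)) u := fun u =>
    (hasDerivAt_conj y (y * x - x * y) u).sub (hasDerivAt_conj' x (y * x - x * y) u)
  have hcomm : (y * x - x * y) * x - x * (y * x - x * y) = x * (x * y - y * x) - (x * y - y * x) * x := by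
    noncomm_ring
  -- ‖T''‖ ≤ K on [0, τ)
  have hT''bound : ∀ u ∈ Ico (0 : ℝ) τ,
      ‖exp (u • y) * (y * (y * x - x * y) - (y * x - x * y) * y) * exp ((-u) • y) -
        exp ((-u) • x) * ((y * x - x * y) * x - x * (y * x - x * y)) * exp (u • x)‖ ≤ K := by
    intro u hu
    have hu' : u ∈ Icc (0 : ℝ) τ := ⟨hu.1, hu.2.le⟩
    rw [hcomm]
    exact (norm_sub_le _ _).trans (add_le_add (norm_conj_le (hy u hu') (hy' u hu'))
      (norm_conj_le (hx' u hu') (hx u hu')))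
  -- ‖T'(u)‖ ≤ K u since T'(0) = 0
  have hT'0 : T' 0 = 0 := by simp [hT']
  have hT'bound : ∀ u ∈ Ico (0 : ℝ) τ, ‖T' u‖ ≤ K * u := by
    intro u hu
    have h := norm_image_sub_le_of_norm_deriv_le_segment' (f := T') (a := 0) (b := τ)
      (fun s _ => (hT'd s).hasDerivWithinAt) hT''bound u ⟨hu.1, hu.2.le⟩
    simpa [hT'0] using h
  -- ‖T(u)‖ ≤ K u² / 2 since T(0) = 0
  have hT0 : T 0 = 0 := by simp [hT]
  have hcont : ContinuousOn (fun u => T u) (Icc 0 τ) := HasDerivAt.continuousOn fun u _ => hTd u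
  have hB : ∀ u : ℝ, HasDerivAt (fun u : ℝ => K * u ^ 2 / 2) (K * u) u := by
    intro u
    have h := ((hasDerivAt_pow 2 u).const_mul K).div_const 2
    have heq : K * ((2 : ℕ) * u ^ (2 - 1)) / 2 = K * u := by norm_num; ring
    rw [heq] at h
    exact h
  have h0 : ‖T 0‖ ≤ K * (0 : ℝ) ^ 2 / 2 := by simp [hT0]
  have key := image_norm_le_of_norm_deriv_right_le_deriv_boundary hcont
    (fun u _ => (hTd u).hasDerivWithinAt) h0 hB hT'bound (right_mem_Icc.2 hτ)
  calc ‖T τ‖ ≤ K * τ ^ 2 / 2 := key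
    _ = τ ^ 2 / 2 * K := by ring

/-- `e^{τ y} e^{-τ y} = 1` (plumbing). [folklore] -/
private theorem exp_smul_mul_exp_neg_smul (y : 𝔸) (τ : ℝ) : exp (τ • y) * exp ((-τ) • y) = 1 := by
  letI : NormedAlgebra ℚ 𝔸 := NormedAlgebra.restrictScalars ℚ ℝ 𝔸
  rw [← exp_add_of_commute ((Commute.refl y).smul_left τ |>.smul_right (-τ)), neg_smul,
    add_neg_cancel, exp_zero]

/-- `e^{-τ x} e^{τ x} = 1` (plumbing). [folklore] -/
private theorem exp_neg_smul_mul_exp_smul (x : 𝔸) (τ : ℝ) : exp ((-τ) • x) * exp (τ • x) = 1 := by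
  letI : NormedAlgebra ℚ 𝔸 := NormedAlgebra.restrictScalars ℚ ℝ 𝔸
  rw [← exp_add_of_commute ((Commute.refl x).smul_left (-τ) |>.smul_right τ), neg_smul,
    neg_add_cancel, exp_zero]

omit [NormedAlgebra ℝ 𝔸] [CompleteSpace 𝔸] in
/-- The algebraic identity behind the variation-of-parameters formula for `𝒮₂` (plumbing):
with `a = e^{τx}`, `b = e^{τy}`, `a' = e^{-τx}`, `b' = e^{-τy}`, `E = e^{(t-τ)h}`, `h = x + y + x`,
`-hE·aba + E·(aba)' = E·a·T·b·a`. [folklore] -/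
private theorem strang_identity (a b a' b' x y E : 𝔸) (hax : x * a = a * x) (hbb : b' * b = 1)
    (haa : a * a' = 1) (hE : (x + y + x) * E = E * (x + y + x)) :
    -((x + y + x) * E) * (a * b * a) + E * ((a * x * b + a * (y * b)) * a + a * b * (x * a)) =
      E * (a * ((b * x * b' - x) - (a' * y * a - y)) * (b * a)) := by
  rw [hE]
  have lhs : -(E * (x + y + x)) * (a * b * a) =
      -(E * (a * x) * b * a) - E * y * a * b * a - E * (a * x) * b * a := by
    calc -(E * (x + y + x)) * (a * b * a)
        = -(E * (x * a) * b * a) - E * y * a * b * a - E * (x * a) * b * a := by noncomm_ring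
      _ = -(E * (a * x) * b * a) - E * y * a * b * a - E * (a * x) * b * a := by rw [hax]
  have rhs : E * (a * ((b * x * b' - x) - (a' * y * a - y)) * (b * a)) =
      E * a * b * x * ((b' * b) * a) - E * a * x * b * a - E * (a * a') * y * a * b * a +
        E * a * y * b * a := by
    noncomm_ring
  rw [lhs, rhs, hbb, haa]
  noncomm_ring

/-- **Tight error bound for the second-order (Suzuki / Strang) formula, two summands, contraction
form.** If `e^{±s x}`, `e^{±s y}` and `e^{s(x+y+x)}` are contractions for `s ∈ [0,t]` (the printed
anti-Hermitian case `x = -iA/2`, `y = -iB`, `x + y + x = -i(A+B)`), then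
`‖e^{tx} e^{ty} e^{tx} - e^{t(x+y+x)}‖ ≤ (t³/6)(‖[y,[y,x]]‖ + ‖[x,[x,y]]‖)`, which for `x = -iA/2`,
`y = -iB` is the printed `‖𝒮₂(t) - e^{-itH}‖ ≤ (t³/12)‖[B,[B,A]]‖ + (t³/24)‖[A,[A,B]]‖`. Proof as
printed: `𝒮₂(t) = e^{-itH} + ∫₀ᵗ e^{-i(t-τ₁)H} e^{-iτ₁A/2} 𝒯₂(τ₁) e^{-iτ₁B} e^{-iτ₁A/2} dτ₁` with
`𝒯₂(τ₁) = O(τ₁²)` (`norm_orderTwo_le`), mean value inequalities in place of the integrals.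
[cite: ChildsSuTranWiebeZhu2021, §5.1 Proposition 12 (Γ = 2)] -/
theorem norm_strang_sub_exp_le_comm (x y : 𝔸) {t : ℝ} (ht : 0 ≤ t)
    (hx : ∀ s ∈ Icc (0 : ℝ) t, ‖exp (s • x)‖ ≤ 1) (hx' : ∀ s ∈ Icc (0 : ℝ) t, ‖exp ((-s) • x)‖ ≤ 1)
    (hy : ∀ s ∈ Icc (0 : ℝ) t, ‖exp (s • y)‖ ≤ 1) (hy' : ∀ s ∈ Icc (0 : ℝ) t, ‖exp ((-s) • y)‖ ≤ 1)
    (hh : ∀ s ∈ Icc (0 : ℝ) t, ‖exp (s • (x + y + x))‖ ≤ 1) :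
    ‖exp (t • x) * exp (t • y) * exp (t • x) - exp (t • (x + y + x))‖ ≤
      t ^ 3 / 6 * (‖y * (y * x - x * y) - (y * x - x * y) * y‖ +
        ‖x * (x * y - y * x) - (x * y - y * x) * x‖) := by
  set K : ℝ := ‖y * (y * x - x * y) - (y * x - x * y) * y‖ +
    ‖x * (x * y - y * x) - (x * y - y * x) * x‖ with hK
  have hK0 : 0 ≤ K := add_nonneg (norm_nonneg _) (norm_nonneg _)
  set h : 𝔸 := x + y + x with hhdef
  set F : ℝ → 𝔸 := fun τ => exp ((t - τ) • h) * (exp (τ • x) * exp (τ • y) * exp (τ • x)) with hF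
  -- derivative of 𝒮₂
  have hS : ∀ τ, HasDerivAt (fun u : ℝ => exp (u • x) * exp (u • y) * exp (u • x))
      ((exp (τ • x) * x * exp (τ • y) + exp (τ • x) * (y * exp (τ • y))) * exp (τ • x) +
        exp (τ • x) * exp (τ • y) * (x * exp (τ • x))) τ := fun τ =>
    ((hasDerivAt_exp_smul_const (𝕂 := ℝ) x τ).mul (hasDerivAt_exp_smul_const' (𝕂 := ℝ) y τ)).mul
      (hasDerivAt_exp_smul_const' (𝕂 := ℝ) x τ)
  have hF' : ∀ τ, HasDerivAt F (exp ((t - τ) • h) * (exp (τ • x) *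
      ((exp (τ • y) * x * exp ((-τ) • y) - x) - (exp ((-τ) • x) * y * exp (τ • x) - y)) *
        (exp (τ • y) * exp (τ • x)))) τ := by
    intro τ
    have hd := (hasDerivAt_exp_sub_smul h t τ).mul (hS τ)
    refine hd.congr_deriv ?_
    exact strang_identity _ _ _ _ x y _ ((exp_smul_comm x τ).symm) (exp_neg_smul_mul_exp_smul y τ)
      (exp_smul_mul_exp_neg_smul x τ) ((exp_smul_comm h (t - τ)).symm)
  -- ‖F'(τ)‖ ≤ K τ² / 2
  have hbound : ∀ τ ∈ Ico (0 : ℝ) t, ‖exp ((t - τ) • h) * (exp (τ • x) *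
      ((exp (τ • y) * x * exp ((-τ) • y) - x) - (exp ((-τ) • x) * y * exp (τ • x) - y)) *
        (exp (τ • y) * exp (τ • x)))‖ ≤ K * τ ^ 2 / 2 := by
    intro τ hτ
    have hτ' : τ ∈ Icc (0 : ℝ) t := ⟨hτ.1, hτ.2.le⟩
    have hsub : ∀ s ∈ Icc (0 : ℝ) τ, s ∈ Icc (0 : ℝ) t := fun s hs => ⟨hs.1, hs.2.trans hτ.2.le⟩
    have hT := norm_orderTwo_le x y hτ.1 (fun s hs => hx s (hsub s hs)) (fun s hs => hx' s (hsub s hs))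
      (fun s hs => hy s (hsub s hs)) (fun s hs => hy' s (hsub s hs))
    have e1 : ‖exp ((t - τ) • h)‖ ≤ 1 := hh (t - τ) ⟨by linarith [hτ.2.le], by linarith [hτ.1]⟩
    have e2 : ‖exp (τ • x)‖ ≤ 1 := hx τ hτ'
    have e3 : ‖exp (τ • y) * exp (τ • x)‖ ≤ 1 :=
      (norm_mul_le _ _).trans (by nlinarith [hy τ hτ', hx τ hτ', norm_nonneg (exp (τ • y)), norm_nonneg (exp (τ • x))])
    have hTK : 0 ≤ τ ^ 2 / 2 * K := by positivity
    calc _ ≤ ‖exp ((t - τ) • h)‖ * ‖exp (τ • x) *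
          ((exp (τ • y) * x * exp ((-τ) • y) - x) - (exp ((-τ) • x) * y * exp (τ • x) - y)) *
            (exp (τ • y) * exp (τ • x))‖ := norm_mul_le _ _
      _ ≤ 1 * (τ ^ 2 / 2 * K) := by
          gcongr
          exact (norm_conj_le e2 e3).trans hT
      _ = K * τ ^ 2 / 2 := by ring
  -- comparison with B(τ) = K τ³ / 6
  have hcont : ContinuousOn (fun τ => F τ - F 0) (Icc 0 t) :=
    HasDerivAt.continuousOn fun τ _ => (hF' τ).sub_const (F 0)
  have hB : ∀ τ : ℝ, HasDerivAt (fun τ : ℝ => K * τ ^ 3 / 6) (K * τ ^ 2 / 2) τ := by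
    intro τ
    have hd := ((hasDerivAt_pow 3 τ).const_mul K).div_const 6
    have heq : K * ((3 : ℕ) * τ ^ (3 - 1)) / 6 = K * τ ^ 2 / 2 := by norm_num; ring
    rw [heq] at hd
    exact hd
  have h0 : ‖F 0 - F 0‖ ≤ K * (0 : ℝ) ^ 3 / 6 := by simp
  have key := image_norm_le_of_norm_deriv_right_le_deriv_boundary hcont
    (fun τ _ => ((hF' τ).sub_const (F 0)).hasDerivWithinAt) h0 hB hbound (right_mem_Icc.2 ht)
  have hFt : F t = exp (t • x) * exp (t • y) * exp (t • x) := by simp [hF]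
  have hF0 : F 0 = exp (t • h) := by simp [hF]
  rw [hFt, hF0] at key
  calc ‖exp (t • x) * exp (t • y) * exp (t • x) - exp (t • h)‖ ≤ K * t ^ 3 / 6 := key
    _ = t ^ 3 / 6 * K := by ring

/-- **`r` second-order Trotter steps**: under the contraction hypotheses of
`norm_strang_sub_exp_le_comm` on `[0, t]`, for `r = n + 1`,
`‖(e^{(t/r)x} e^{(t/r)y} e^{(t/r)x})^r − e^{t(x+y+x)}‖ ≤ (t³/(6r²))(‖[y,[y,x]]‖ + ‖[x,[x,y]]‖)` —
“`‖𝒮^r(t/r) − e^{tH}‖ ≤ r‖𝒮(t/r) − e^{(t/r)H}‖`” combined with the two-term second-order bound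
(for `x = −iA/2`, `y = −iB`: `(t³/(12r²))‖[B,[B,A]]‖ + (t³/(24r²))‖[A,[A,B]]‖`).
[cite: ChildsSuTranWiebeZhu2021, §2.2 (error accumulation over r steps) and §5.1 Proposition 12 (Γ = 2)] -/
theorem norm_strang_pow_sub_exp_le_comm [NormOneClass 𝔸] (x y : 𝔸) {t : ℝ} (ht : 0 ≤ t)
    (hx : ∀ s ∈ Icc (0 : ℝ) t, ‖exp (s • x)‖ ≤ 1) (hx' : ∀ s ∈ Icc (0 : ℝ) t, ‖exp ((-s) • x)‖ ≤ 1)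
    (hy : ∀ s ∈ Icc (0 : ℝ) t, ‖exp (s • y)‖ ≤ 1) (hy' : ∀ s ∈ Icc (0 : ℝ) t, ‖exp ((-s) • y)‖ ≤ 1)
    (hh : ∀ s ∈ Icc (0 : ℝ) t, ‖exp (s • (x + y + x))‖ ≤ 1) (n : ℕ) :
    ‖(exp ((t / (n + 1)) • x) * exp ((t / (n + 1)) • y) * exp ((t / (n + 1)) • x)) ^ (n + 1) -
        exp (t • (x + y + x))‖ ≤
      t ^ 3 / (6 * (n + 1) ^ 2) * (‖y * (y * x - x * y) - (y * x - x * y) * y‖ +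
        ‖x * (x * y - y * x) - (x * y - y * x) * x‖) := by
  set K : ℝ := ‖y * (y * x - x * y) - (y * x - x * y) * y‖ +
    ‖x * (x * y - y * x) - (x * y - y * x) * x‖ with hK
  have hK0 : 0 ≤ K := add_nonneg (norm_nonneg _) (norm_nonneg _)
  have hn : (0 : ℝ) < n + 1 := by positivity
  have hτ0 : 0 ≤ t / (n + 1) := div_nonneg ht hn.le
  have hτt : t / (n + 1) ≤ t := div_le_self ht (by linarith)
  have hsub : ∀ s ∈ Icc (0 : ℝ) (t / (n + 1)), s ∈ Icc (0 : ℝ) t := fun s hs => ⟨hs.1, hs.2.trans hτt⟩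
  have hstep := norm_strang_sub_exp_le_comm x y hτ0 (fun s hs => hx s (hsub s hs))
    (fun s hs => hx' s (hsub s hs)) (fun s hs => hy s (hsub s hs)) (fun s hs => hy' s (hsub s hs))
    (fun s hs => hh s (hsub s hs))
  have e1 := hx _ ⟨hτ0, hτt⟩
  have e2 := hy _ ⟨hτ0, hτt⟩
  have hX : ‖exp ((t / (n + 1)) • x) * exp ((t / (n + 1)) • y) * exp ((t / (n + 1)) • x)‖ ≤ 1 :=
    (norm_conj_le e1 e1).trans e2
  have hY : ‖exp ((t / (n + 1)) • (x + y + x))‖ ≤ 1 := hh _ ⟨hτ0, hτt⟩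
  have hpow : exp (t • (x + y + x)) = exp ((t / (n + 1)) • (x + y + x)) ^ (n + 1) := by
    letI : NormedAlgebra ℚ 𝔸 := NormedAlgebra.restrictScalars ℚ ℝ 𝔸
    rw [← exp_nsmul, ← Nat.cast_smul_eq_nsmul ℝ, smul_smul]
    congr 1
    push_cast
    field_simp
  rw [hpow]
  have htel := Literature.MathematicalPhysics.QuantumLattice.norm_pow_sub_pow_le'
    (exp ((t / (n + 1)) • x) * exp ((t / (n + 1)) • y) * exp ((t / (n + 1)) • x))
    (exp ((t / (n + 1)) • (x + y + x))) hX hY n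
  rw [one_pow, mul_one] at htel
  calc ‖(exp ((t / (n + 1)) • x) * exp ((t / (n + 1)) • y) * exp ((t / (n + 1)) • x)) ^ (n + 1) -
          exp ((t / (n + 1)) • (x + y + x)) ^ (n + 1)‖
      ≤ (n + 1) * ‖exp ((t / (n + 1)) • x) * exp ((t / (n + 1)) • y) * exp ((t / (n + 1)) • x) -
          exp ((t / (n + 1)) • (x + y + x))‖ := htel
    _ ≤ (n + 1) * ((t / (n + 1)) ^ 3 / 6 * K) := by gcongr
    _ = t ^ 3 / (6 * (n + 1) ^ 2) * K := by field_simp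

/-! ### Second order, `Γ` summands (Proposition 12) -/

/-- The doubled sum `Σ_γ (x_γ + x_γ)` of a list of HALF summands `x_γ` (= `-iH_γ/2`), written as
`x + (Σ rest) + x` so that the two-term bound applies literally. [cite: ChildsSuTranWiebeZhu2021, §5.1 Proposition 12] -/
def doubleSum : List 𝔸 → 𝔸
  | [] => 0
  | x :: rest => x + doubleSum rest + x

omit [NormedAlgebra ℝ 𝔸] [CompleteSpace 𝔸] in
/-- `doubleSum [] = 0`. [cite: ChildsSuTranWiebeZhu2021, §5.1 Proposition 12] -/
@[simp] theorem doubleSum_nil : doubleSum ([] : List 𝔸) = 0 := rfl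

omit [NormedAlgebra ℝ 𝔸] [CompleteSpace 𝔸] in
/-- `doubleSum (x :: rest) = x + doubleSum rest + x`. [cite: ChildsSuTranWiebeZhu2021, §5.1 Proposition 12] -/
@[simp] theorem doubleSum_cons (x : 𝔸) (rest : List 𝔸) :
    doubleSum (x :: rest) = x + doubleSum rest + x := rfl

/-- The second-order (Suzuki / Strang) product formula for HALF summands `[x_1, …, x_Γ]`:
`𝒮₂(t) = e^{t x_1} ⋯ e^{t x_Γ} · e^{t x_Γ} ⋯ e^{t x_1}`, i.e. `e^{tx} 𝒮₂(t)[rest] e^{tx}` for `x :: rest`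
(with `x_γ = -iH_γ/2`: `∏_{γ=Γ}^{1} e^{-i(t/2)H_γ} ∏_{γ=1}^{Γ} e^{-i(t/2)H_γ}` up to the labelling
order of the summands). [cite: ChildsSuTranWiebeZhu2021, §2.1 (second-order Suzuki formula) and §5.1 Proposition 12] -/
def strang (t : ℝ) : List 𝔸 → 𝔸
  | [] => 1
  | x :: rest => exp (t • x) * strang t rest * exp (t • x)

omit [CompleteSpace 𝔸] in
/-- No summands: the empty product. [cite: ChildsSuTranWiebeZhu2021, §2.1] -/
@[simp] theorem strang_nil (t : ℝ) : strang t ([] : List 𝔸) = 1 := rfl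

omit [CompleteSpace 𝔸] in
/-- `𝒮₂(t)[x :: rest] = e^{tx} 𝒮₂(t)[rest] e^{tx}`. [cite: ChildsSuTranWiebeZhu2021, §2.1] -/
theorem strang_cons (t : ℝ) (x : 𝔸) (rest : List 𝔸) :
    strang t (x :: rest) = exp (t • x) * strang t rest * exp (t • x) := rfl

/-- The nested-commutator sum of Proposition 12 for HALF summands: for `x :: rest` with
`D = doubleSum rest` the term `‖[D,[D,x]]‖ + ‖[x,[x,D]]‖`, plus the sum for `rest`
(= `½‖[Σ_{>γ}H,[Σ_{>γ}H,H_γ]]‖ + ¼‖[H_γ,[H_γ,Σ_{>γ}H]]‖` for `x_γ = -iH_γ/2`).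
[cite: ChildsSuTranWiebeZhu2021, §5.1 Proposition 12] -/
def secondOrderCommSum : List 𝔸 → ℝ
  | [] => 0
  | x :: rest =>
    (‖doubleSum rest * (doubleSum rest * x - x * doubleSum rest) -
        (doubleSum rest * x - x * doubleSum rest) * doubleSum rest‖ +
      ‖x * (x * doubleSum rest - doubleSum rest * x) - (x * doubleSum rest - doubleSum rest * x) * x‖) +
    secondOrderCommSum rest

omit [NormedAlgebra ℝ 𝔸] [CompleteSpace 𝔸] in
/-- `secondOrderCommSum` is nonnegative. [cite: ChildsSuTranWiebeZhu2021, §5.1 Proposition 12] -/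
theorem secondOrderCommSum_nonneg : ∀ xs : List 𝔸, 0 ≤ secondOrderCommSum xs
  | [] => le_rfl
  | _ :: rest => add_nonneg (add_nonneg (norm_nonneg _) (norm_nonneg _)) (secondOrderCommSum_nonneg rest)

/-- **Proposition 12 (tight error bound for the second-order Suzuki formula), contraction form.**
For half summands `x_1, …, x_Γ` such that `e^{±s x_γ}`, `e^{±s D_γ}` and `e^{s (x_γ + D_γ + x_γ)}` are
contractions on `[0,t]` for every `γ` (`D_γ = doubleSum` of the later summands; automatic for
anti-Hermitian summands), `‖𝒮₂(t) − e^{t Σ(x_γ+x_γ)}‖ ≤ (t³/6)·secondOrderCommSum`, i.e. the printed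
`(t³/12)Σ‖[Σ_{>γ}H,[Σ_{>γ}H,H_γ]]‖ + (t³/24)Σ‖[H_γ,[H_γ,Σ_{>γ}H]]‖` for `x_γ = −iH_γ/2`. Proof as
printed: telescoping triangle inequality with one two-term Strang bound per summand.
[cite: ChildsSuTranWiebeZhu2021, §5.1 Proposition 12] -/
theorem norm_strang_sub_exp_le (t : ℝ) (ht : 0 ≤ t) :
    ∀ xs : List 𝔸,
      (∀ x ∈ xs, ∀ s ∈ Icc (0 : ℝ) t, ‖exp (s • x)‖ ≤ 1 ∧ ‖exp ((-s) • x)‖ ≤ 1) →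
      (∀ zs : List 𝔸, zs <:+ xs → ∀ s ∈ Icc (0 : ℝ) t,
        ‖exp (s • doubleSum zs)‖ ≤ 1 ∧ ‖exp ((-s) • doubleSum zs)‖ ≤ 1) →
      ‖strang t xs - exp (t • doubleSum xs)‖ ≤ t ^ 3 / 6 * secondOrderCommSum xs
  | [], _, _ => by simp [secondOrderCommSum]
  | x :: rest, hel, hsuf => by
    have ih := norm_strang_sub_exp_le t ht rest (fun y hy => hel y (List.mem_cons_of_mem x hy))
      (fun zs hzs => hsuf zs (hzs.trans (List.suffix_cons x rest)))
    have hx : ∀ s ∈ Icc (0 : ℝ) t, ‖exp (s • x)‖ ≤ 1 := fun s hs => (hel x List.mem_cons_self s hs).1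
    have hx' : ∀ s ∈ Icc (0 : ℝ) t, ‖exp ((-s) • x)‖ ≤ 1 := fun s hs => (hel x List.mem_cons_self s hs).2
    have hD : ∀ s ∈ Icc (0 : ℝ) t, ‖exp (s • doubleSum rest)‖ ≤ 1 :=
      fun s hs => (hsuf rest (List.suffix_cons x rest) s hs).1
    have hD' : ∀ s ∈ Icc (0 : ℝ) t, ‖exp ((-s) • doubleSum rest)‖ ≤ 1 :=
      fun s hs => (hsuf rest (List.suffix_cons x rest) s hs).2
    have hxDx : ∀ s ∈ Icc (0 : ℝ) t, ‖exp (s • (x + doubleSum rest + x))‖ ≤ 1 :=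
      fun s hs => (hsuf (x :: rest) (List.suffix_refl _) s hs).1
    have h2 := norm_strang_sub_exp_le_comm x (doubleSum rest) ht hx hx' hD hD' hxDx
    rw [strang_cons, doubleSum_cons, secondOrderCommSum]
    have hsplit : exp (t • x) * strang t rest * exp (t • x) - exp (t • (x + doubleSum rest + x)) =
        exp (t • x) * (strang t rest - exp (t • doubleSum rest)) * exp (t • x) +
          (exp (t • x) * exp (t • doubleSum rest) * exp (t • x) - exp (t • (x + doubleSum rest + x))) := by
      noncomm_ring
    rw [hsplit]
    have hxt : ‖exp (t • x)‖ ≤ 1 := hx t ⟨ht, le_rfl⟩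
    calc ‖exp (t • x) * (strang t rest - exp (t • doubleSum rest)) * exp (t • x) +
          (exp (t • x) * exp (t • doubleSum rest) * exp (t • x) - exp (t • (x + doubleSum rest + x)))‖
        ≤ ‖strang t rest - exp (t • doubleSum rest)‖ +
            ‖exp (t • x) * exp (t • doubleSum rest) * exp (t • x) - exp (t • (x + doubleSum rest + x))‖ :=
          (norm_add_le _ _).trans (add_le_add (norm_conj_le hxt hxt) le_rfl)
      _ ≤ t ^ 3 / 6 * secondOrderCommSum rest +
            t ^ 3 / 6 * (‖doubleSum rest * (doubleSum rest * x - x * doubleSum rest) -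
                (doubleSum rest * x - x * doubleSum rest) * doubleSum rest‖ +
              ‖x * (x * doubleSum rest - doubleSum rest * x) - (x * doubleSum rest - doubleSum rest * x) * x‖) :=
          add_le_add ih h2
      _ = _ := by ring

end TrotterError

/-! ### The printed form: Hermitian summands in a C⋆-algebra -/

section CStar

open TrotterError

variable {A : Type*} [CStarAlgebra A]

/-- In a C⋆-algebra, `e^{s x}` is a contraction for skew-adjoint `x` (it is unitary).
[cite: ChildsSuTranWiebeZhu2021, §2.2 (“we directly evaluate the spectral norm of a matrix exponential to 1”)] -/
theorem norm_exp_smul_le_one_of_mem_skewAdjoint {x : A} (hx : x ∈ skewAdjoint A) (s : ℝ) :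
    ‖exp (s • x)‖ ≤ 1 := by
  letI : NormedAlgebra ℚ A := NormedAlgebra.restrictScalars ℚ ℝ A
  have hs : s • x ∈ skewAdjoint A := skewAdjoint.smul_mem s hx
  have hu : exp (s • x) ∈ unitary A := NormedSpace.exp_mem_unitary_of_mem_skewAdjoint hs
  rcases subsingleton_or_nontrivial A with h | h
  · simp [Subsingleton.elim (exp (s • x)) 0]
  · exact (CStarRing.norm_of_mem_unitary hu).le

/-- **Tight error bound for the first-order Lie–Trotter formula, two Hermitian summands**
(Childs–Su–Tran–Wiebe–Zhu): for self-adjoint `A`, `B` in a C⋆-algebra and `t ≥ 0`, with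
`𝒮₁(t) = e^{-itB} e^{-itA}` and `H = A + B`,
`‖𝒮₁(t) - e^{-itH}‖ ≤ (t²/2) ‖[B, A]‖`.
Here `e^{-itB} = exp (t • x)` with `x = -(I • B)` etc.; the commutator `[x, y]` of `x = -iB`,
`y = -iA` has the norm of `[B, A]`. [cite: ChildsSuTranWiebeZhu2021, §5.1 (eq. ‖𝒮₁(t) − e^{−itH}‖ ≤ (t²/2)‖[B,A]‖; Proposition 11 with Γ = 2)] -/
theorem norm_lieTrotter_one_sub_exp_le_of_isSelfAdjoint (A₁ B : A) (hA : IsSelfAdjoint A₁)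
    (hB : IsSelfAdjoint B) {t : ℝ} (ht : 0 ≤ t) :
    ‖exp (t • -(Complex.I • B)) * exp (t • -(Complex.I • A₁)) -
        exp (t • -(Complex.I • (A₁ + B)))‖ ≤ t ^ 2 / 2 * ‖B * A₁ - A₁ * B‖ := by
  have hxB : -(Complex.I • B) ∈ skewAdjoint A := (skewAdjoint A).neg_mem (hB.smul_mem_skewAdjoint Complex.conj_I)
  have hxA : -(Complex.I • A₁) ∈ skewAdjoint A := (skewAdjoint A).neg_mem (hA.smul_mem_skewAdjoint Complex.conj_I)
  have hsum : -(Complex.I • B) + -(Complex.I • A₁) = -(Complex.I • (A₁ + B)) := by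
    rw [smul_add]; abel
  have hxAB : -(Complex.I • B) + -(Complex.I • A₁) ∈ skewAdjoint A := (skewAdjoint A).add_mem hxB hxA
  have key := norm_exp_mul_exp_sub_exp_add_le_comm (-(Complex.I • B)) (-(Complex.I • A₁)) ht
    (fun s _ => norm_exp_smul_le_one_of_mem_skewAdjoint hxB s)
    (fun s _ => norm_exp_smul_le_one_of_mem_skewAdjoint hxA s)
    (fun s _ => norm_exp_smul_le_one_of_mem_skewAdjoint hxAB s)
  rw [hsum] at key
  have hprod : ∀ P Q : A, -(Complex.I • P) * -(Complex.I • Q) = -(P * Q) := by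
    intro P Q
    rw [neg_mul_neg, smul_mul_assoc, mul_smul_comm, smul_smul, Complex.I_mul_I, neg_one_smul]
  have hcomm : -(Complex.I • B) * -(Complex.I • A₁) - -(Complex.I • A₁) * -(Complex.I • B) =
      -(B * A₁ - A₁ * B) := by
    rw [hprod, hprod]
    abel
  rw [hcomm, norm_neg] at key
  exact key

/-- **`r` Trotter steps, two Hermitian summands**: for self-adjoint `A`, `B` in a (nontrivial)
C⋆-algebra, `t ≥ 0` and `r ≥ 1`, `‖𝒮₁(t/r)^r - e^{-itH}‖ ≤ (t²/(2r)) ‖[B, A]‖`, from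
`‖𝒮^r(t/r) − e^{tH}‖ ≤ r‖𝒮(t/r) − e^{(t/r)H}‖` and the one-step bound.
[cite: ChildsSuTranWiebeZhu2021, §2.2 (error accumulation over r steps) and §5.1 (Proposition 11, Γ = 2)] -/
theorem norm_lieTrotter_pow_sub_exp_le_of_isSelfAdjoint [Nontrivial A] (A₁ B : A)
    (hA : IsSelfAdjoint A₁) (hB : IsSelfAdjoint B) {t : ℝ} (ht : 0 ≤ t) (n : ℕ) :
    ‖(exp ((t / (n + 1)) • -(Complex.I • B)) * exp ((t / (n + 1)) • -(Complex.I • A₁))) ^ (n + 1) -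
        exp (t • -(Complex.I • (A₁ + B)))‖ ≤ t ^ 2 / (2 * (n + 1)) * ‖B * A₁ - A₁ * B‖ := by
  have hxB : -(Complex.I • B) ∈ skewAdjoint A := (skewAdjoint A).neg_mem (hB.smul_mem_skewAdjoint Complex.conj_I)
  have hxA : -(Complex.I • A₁) ∈ skewAdjoint A := (skewAdjoint A).neg_mem (hA.smul_mem_skewAdjoint Complex.conj_I)
  have hsum : -(Complex.I • B) + -(Complex.I • A₁) = -(Complex.I • (A₁ + B)) := by
    rw [smul_add]; abel
  have hxAB : -(Complex.I • B) + -(Complex.I • A₁) ∈ skewAdjoint A := (skewAdjoint A).add_mem hxB hxA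
  have key := norm_lieTrotter_sub_exp_le_comm (-(Complex.I • B)) (-(Complex.I • A₁)) ht
    (fun s _ => norm_exp_smul_le_one_of_mem_skewAdjoint hxB s)
    (fun s _ => norm_exp_smul_le_one_of_mem_skewAdjoint hxA s)
    (fun s _ => norm_exp_smul_le_one_of_mem_skewAdjoint hxAB s) n
  rw [hsum] at key
  have hprod : ∀ P Q : A, -(Complex.I • P) * -(Complex.I • Q) = -(P * Q) := by
    intro P Q
    rw [neg_mul_neg, smul_mul_assoc, mul_smul_comm, smul_smul, Complex.I_mul_I, neg_one_smul]
  have hcomm : -(Complex.I • B) * -(Complex.I • A₁) - -(Complex.I • A₁) * -(Complex.I • B) =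
      -(B * A₁ - A₁ * B) := by
    rw [hprod, hprod]
    abel
  rw [hcomm, norm_neg] at key
  exact key


/-- **Second-order (Suzuki / Strang) formula, skew-adjoint summands in a C⋆-algebra.** For
skew-adjoint `x`, `y` (i.e. `x = -iA/2`, `y = -iB` with `A`, `B` self-adjoint, so that
`e^{tx}e^{ty}e^{tx} = 𝒮₂(t) = e^{-itA/2}e^{-itB}e^{-itA/2}` and `e^{t(x+y+x)} = e^{-it(A+B)}`) and `t ≥ 0`:
`‖e^{tx}e^{ty}e^{tx} - e^{t(x+y+x)}‖ ≤ (t³/6)(‖[y,[y,x]]‖ + ‖[x,[x,y]]‖)`; with the substitution this is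
the printed `‖𝒮₂(t) - e^{-itH}‖ ≤ (t³/12)‖[B,[B,A]]‖ + (t³/24)‖[A,[A,B]]‖` (`‖[y,[y,x]]‖ = ½‖[B,[B,A]]‖`,
`‖[x,[x,y]]‖ = ¼‖[A,[A,B]]‖`). [cite: ChildsSuTranWiebeZhu2021, §5.1 Proposition 12 (Γ = 2)] -/
theorem norm_strang_sub_exp_le_of_mem_skewAdjoint {x y : A} (hx : x ∈ skewAdjoint A)
    (hy : y ∈ skewAdjoint A) {t : ℝ} (ht : 0 ≤ t) :
    ‖exp (t • x) * exp (t • y) * exp (t • x) - exp (t • (x + y + x))‖ ≤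
      t ^ 3 / 6 * (‖y * (y * x - x * y) - (y * x - x * y) * y‖ +
        ‖x * (x * y - y * x) - (x * y - y * x) * x‖) := by
  have hh : x + y + x ∈ skewAdjoint A := (skewAdjoint A).add_mem ((skewAdjoint A).add_mem hx hy) hx
  exact norm_strang_sub_exp_le_comm x y ht (fun s _ => norm_exp_smul_le_one_of_mem_skewAdjoint hx s)
    (fun s _ => norm_exp_smul_le_one_of_mem_skewAdjoint hx (-s))
    (fun s _ => norm_exp_smul_le_one_of_mem_skewAdjoint hy s)
    (fun s _ => norm_exp_smul_le_one_of_mem_skewAdjoint hy (-s))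
    (fun s _ => norm_exp_smul_le_one_of_mem_skewAdjoint hh s)

/-- `[aP, bQ] = ab·[P, Q]` for scalars `a b : ℂ` (plumbing). [folklore] -/
private theorem smul_comm_smul (a b : ℂ) (P Q : A) :
    (a • P) * (b • Q) - (b • Q) * (a • P) = (a * b) • (P * Q - Q * P) := by
  rw [smul_mul_smul_comm, smul_mul_smul_comm, mul_comm b a, smul_sub]

/-- **Proposition 12 (Γ = 2) as printed**: for self-adjoint `A`, `B` in a C⋆-algebra, `H = A + B`,
`𝒮₂(t) = e^{-i(t/2)A} e^{-itB} e^{-i(t/2)A}` and `t ≥ 0`,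
`‖𝒮₂(t) − e^{−itH}‖ ≤ (t³/12)‖[B,[B,A]]‖ + (t³/24)‖[A,[A,B]]‖` (exponents written `t·(−(i/2)A)`,
`t·(−iB)`, `t·(−i(A+B))`). [cite: ChildsSuTranWiebeZhu2021, §5.1 Proposition 12 (Γ = 2)] -/
theorem norm_strang_sub_exp_le_of_isSelfAdjoint (A₁ B : A) (hA : IsSelfAdjoint A₁)
    (hB : IsSelfAdjoint B) {t : ℝ} (ht : 0 ≤ t) :
    ‖exp (t • ((-Complex.I / 2) • A₁)) * exp (t • -(Complex.I • B)) *
          exp (t • ((-Complex.I / 2) • A₁)) - exp (t • -(Complex.I • (A₁ + B)))‖ ≤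
      t ^ 3 / 12 * ‖B * (B * A₁ - A₁ * B) - (B * A₁ - A₁ * B) * B‖ +
        t ^ 3 / 24 * ‖A₁ * (A₁ * B - B * A₁) - (A₁ * B - B * A₁) * A₁‖ := by
  have hc : (-Complex.I / 2) ∈ skewAdjoint ℂ := by
    rw [skewAdjoint.mem_iff, Complex.star_def, map_div₀, map_neg, Complex.conj_I, map_ofNat]; ring
  have hx : (-Complex.I / 2) • A₁ ∈ skewAdjoint A := hA.smul_mem_skewAdjoint hc
  have hy : -(Complex.I • B) ∈ skewAdjoint A :=
    (skewAdjoint A).neg_mem (hB.smul_mem_skewAdjoint Complex.conj_I)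
  have key := norm_strang_sub_exp_le_of_mem_skewAdjoint hx hy ht
  have hsum : (-Complex.I / 2) • A₁ + -(Complex.I • B) + (-Complex.I / 2) • A₁ =
      -(Complex.I • (A₁ + B)) := by module
  rw [hsum] at key
  -- the two nested commutators are scalar multiples of the printed ones
  have hyx : -(Complex.I • B) = (-Complex.I) • B := (neg_smul _ _).symm
  have h1 : ‖-(Complex.I • B) * (-(Complex.I • B) * (-Complex.I / 2) • A₁ - (-Complex.I / 2) • A₁ * -(Complex.I • B)) -
      (-(Complex.I • B) * (-Complex.I / 2) • A₁ - (-Complex.I / 2) • A₁ * -(Complex.I • B)) * -(Complex.I • B)‖ =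
        1 / 2 * ‖B * (B * A₁ - A₁ * B) - (B * A₁ - A₁ * B) * B‖ := by
    rw [hyx, smul_comm_smul, smul_comm_smul, norm_smul]
    congr 1
    norm_num [Complex.norm_I]
  have h2 : ‖(-Complex.I / 2) • A₁ * ((-Complex.I / 2) • A₁ * -(Complex.I • B) - -(Complex.I • B) * (-Complex.I / 2) • A₁) -
      ((-Complex.I / 2) • A₁ * -(Complex.I • B) - -(Complex.I • B) * (-Complex.I / 2) • A₁) * (-Complex.I / 2) • A₁‖ =
        1 / 4 * ‖A₁ * (A₁ * B - B * A₁) - (A₁ * B - B * A₁) * A₁‖ := by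
    rw [hyx, smul_comm_smul, smul_comm_smul, norm_smul]
    congr 1
    norm_num [Complex.norm_I]
  rw [h1, h2] at key
  calc _ ≤ _ := key
    _ = _ := by ring

end CStar


end Literature.Computability.QuantumAlgorithms

end
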